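import Mathlib
import Summits.Ventures.FusionMHD.Models.CerfonFreidbergIterLikeQHalfMercDefs
import HarnessLib

/-!
# Ventures/FusionMHD — Models/CerfonFreidbergIterLikeQHalfMercPanels15.lean: KERNEL CHECK of the Mercier-register certificates of panel(s) 26, 27 (of 32)
# at `ψ_N = 1/2` of THE Cerfon–Freidberg ITER-like instance

HONEST FRAMING (LADDER-GRIDFUSION three columns; CF rung; «F2.R2-CF-MERCIER-IMPLICIT» step (2), F2-SCOPING v1.6 §10(c)).  One `decide +kernel` (≈ 100 s): for each
listed panel the obligation `CFIterLike.QHalfMerc.MercCert.ok` (`Models/CerfonFreidbergIterLikeQHalfMercDefs.lean`) — the Taylor-model run of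
`progM = progA ++ block1 ++ block2 ++ block3M` over ★ #117's parameter box is ACCEPTED (both `inv` certificates included) and the kernel's FOUR panel-integral
enclosures (`g_W`, `g_Aσ`, `g_AR`, `g_B1` along the approximant) lie inside the claimed integers (read off a compiled `#eval` of the same functions, slack one unit of
`2⁻⁶⁰`; float truth inside every panel, `HOME/models/model-7/g7/genqm/truthM.json`).  MODELLED: analytic Cerfon–Freidberg family; nothing about a device or
stability.  No `native_decide`.  Typer/prover: gridfusion-model-7 (g7), 2026-08-27.
Citations: Jardin 2010 §8.5 (8.134) [Jardin2010]; Mahboubi–Melquiond–Sibut-Pinote 2016 §3.2 Lemma 3 [MahboubiMelquiondSibutpinote2016].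
-/

namespace Summit.Ventures.FusionMHD.Models.CFIterLike.QHalfMerc

/-- Mercier-register certificate data of panel(s) 26, 27. [instance data] -/
def mercCert15 : List MercCert := [
  { j := 26, cand1 := [1082441316894905597952, -4573244956266420764672, 21662964832938389143552, -47965648640874253385728, 13433214324780927287296, 779326180904034818326528, -5245741710347348113096704, 22926655630538056757411840, -70632570368055580316139520, 142181442242395100560752640, 3203270518738002809305694208, -56580902814749737049598722048, -3463106934707528007076489986048],
    cand2 := [762839993295389196288, -2266408641525817540608, 11844922340983697309696, -39646345090239414927360, 131498355110563469590528, -301648206019361729675264, 223452479393446261424128, 3238952134515062283960320, -27713335338860403809583104, 150288447064991341748420608, 1877029572009284406366699520, -2610600824481479749527404544, -3458064416441599384319114084352],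
    deg := 10, e1 := 44, e2 := 43, wlo := 1207971609017790835, whi := 1207971697811909220, slo := 13428423469210276860, shi := 13428423819290465199,
    rlo := 8891766180142823365, rhi := 8891766421504481072, blo := 20279950265721141073, bhi := 20279950772867705020 },
  { j := 27, cand1 := [959250614030703525888, -3355281914999583277056, 17420340632327624327168, -41219451437685439201280, 78641741302011334230016, 161119199317418745790464, -1829626687221566351081472, 9713523746278181401788416, -37246207860443652548460544, 113136241824943908015046656, 2206406304914952728919146496, -11597390560946137221436538880, -2631024527287013873666098200576],
    cand2 := [702488817981334487040, -1627582910560869285888, 8811169172446863425536, -25945892817274597801984, 89740339885108294057984, -225803758427140687659008, 468352296507834726612992, -109545072962050061238272, -5664428553844479154454528, 40805315613538925039058944, 2271127196157983066899349504, -6408023454540181782503882752, -2939291794779279194880233963520],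
    deg := 10, e1 := 44, e2 := 43, wlo := 908461094234312081, whi := 908461168397172268, slo := 11814166781854659733, shi := 11814167111577846914,
    rlo := 7744728481221827018, rhi := 7744728705268726959, blo := 18021984850837793030, bhi := 18021985335584227761 }]

/-- **KERNEL CHECK** of the four Mercier registers on panel(s) 26, 27. -/
theorem mercCert15_ok : CFIterLike.QHalfMerc.mercCert15.all MercCert.ok = true := by
  decide +kernel

end Summit.Ventures.FusionMHD.Models.CFIterLike.QHalfMerc
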